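import Summits.QuantumFields.QCD.Theorems.HeatSlicedQuarksQuarkLoopCoefficientFreeMajorantToolkitAux

/-!
# Quark-loop coefficient, stub `freeMajorantToolkit`, part E: the contour shift

The Brillouin-zone integral of the complexified free integrand
`Φ(ζ) = exp(−t H(ζ) + i ζ·w)` (`H(ζ) = Σ sin² ζ_μ + (Σ (1 − cos ζ_μ))²`, `w ∈ ℤ⁴`) is invariant
under the shift `p ↦ p + iη` of the contour (`η ∈ ℝ⁴`):

  `∫_{[−π,π]⁴} Φ(p + iη) dp = ∫_{[−π,π]⁴} Φ(p) dp`.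

Proof without Fubini and without one-variable complex analysis: apply the divergence theorem
(`MeasureTheory.integral_divergence_of_hasFDerivAt_off_countable'`) on the box
`[0,1] × [−π,π]⁴ ⊂ ℝ⁵` to the field `(Φ∘ζ, −iη₀ Φ∘ζ, …, −iη₃ Φ∘ζ)` with `ζ(s, p) = p + isη`
real-linear in `(s, p)`: its divergence is `DΦ(ζ)[iη] − Σ_μ iη_μ DΦ(ζ)[e_μ] = 0` by complex
linearity of `DΦ`, the side faces `p_μ = ±π` cancel by `2π`-periodicity (`w_μ ∈ ℤ`), and the two
remaining faces `s = 1`, `s = 0` are the two sides of the identity.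
-/

namespace Summit.QuantumFields.QCD.Cruxes.QuarkLoopCoefficient.Sketch.FreeMajorantToolkit

open Summit.QuantumFields.QCD.Theorems.QuarkLoopCoefficient
open Literature.MathematicalPhysics.QuantumLattice Literature.MathematicalPhysics.QuantumFieldTheory
open Literature.Probability.LatticeModels (Site TorusSite)
open scoped Matrix ComplexConjugate
open MeasureTheory

/-- Two insertions at the same slot differ by a multiple of the basis vector of that slot. -/
theorem insertNth_eq_add_single {n : ℕ} (i : Fin (n + 1)) (s s' : ℝ) (x : Fin n → ℝ) :
    (Fin.insertNth i s x : Fin (n + 1) → ℝ) =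
      (Fin.insertNth i s' x : Fin (n + 1) → ℝ) + (Pi.single i (s - s') : Fin (n + 1) → ℝ) := by
  ext j
  rcases Fin.eq_self_or_eq_succAbove i j with rfl | ⟨k, rfl⟩
  · simp
  · simp [Fin.insertNth_apply_succAbove, Fin.succAbove_ne]

/-- The abstract contour shift: if `φ : ℂ⁴ → ℂ` is complex differentiable and `2π`-periodic in
each coordinate, and `Z(s, p) = p + isη` (a real-linear map `ℝ⁵ → ℂ⁴`, `s` the `0`-th
coordinate), then `∫_{[−π,π]⁴} φ(Z(1, p)) dp = ∫_{[−π,π]⁴} φ(Z(0, p)) dp` (divergence theorem on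
`[0,1] × [−π,π]⁴` for the divergence-free field `(φ∘Z, −iη_μ φ∘Z)`). -/
theorem setIntegral_shift_of_periodic (φ : (Fin 4 → ℂ) → ℂ) (hφ : Differentiable ℂ φ)
    (hper : ∀ (ξ : Fin 4 → ℂ) (ν : Fin 4), φ (Function.update ξ ν (ξ ν + 2 * Real.pi)) = φ ξ)
    (Z : (Fin 5 → ℝ) →L[ℝ] (Fin 4 → ℂ)) (η : Fin 4 → ℝ)
    (hZ : ∀ v μ, Z v μ = (v μ.succ : ℂ) + ((v 0 * η μ : ℝ) : ℂ) * Complex.I) :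
    ∫ x in Set.Icc (fun _ : Fin 4 => -Real.pi) (fun _ => Real.pi),
        φ (Z (Fin.cons 1 x : Fin 5 → ℝ)) =
      ∫ x in Set.Icc (fun _ : Fin 4 => -Real.pi) (fun _ => Real.pi),
        φ (Z (Fin.cons 0 x : Fin 5 → ℝ)) := by
  have hφc : Continuous φ := hφ.continuous
  set a : Fin 5 → ℝ := Fin.cons 0 (fun _ => -Real.pi) with ha
  set b : Fin 5 → ℝ := Fin.cons 1 (fun _ => Real.pi) with hb
  have hab : a ≤ b := by
    intro i
    refine Fin.cases ?_ (fun j => ?_) i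
    · simp [ha, hb]
    · simp [ha, hb]; linarith [Real.pi_pos]
  set c : Fin 5 → ℂ := Fin.cons 1 (fun μ => -(η μ : ℂ) * Complex.I) with hc
  set f : Fin 5 → (Fin 5 → ℝ) → ℂ := fun i v => c i * φ (Z v) with hf
  set f' : Fin 5 → (Fin 5 → ℝ) → (Fin 5 → ℝ) →L[ℝ] ℂ :=
    fun i v => c i • ((fderiv ℂ φ (Z v)).restrictScalars ℝ).comp Z with hf'
  have Hd : ∀ v i, HasFDerivAt (f i) (f' i v) v := by
    intro v i
    have h1 : HasFDerivAt (fun v => φ (Z v)) (((fderiv ℂ φ (Z v)).restrictScalars ℝ).comp Z) v :=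
      ((hφ (Z v)).hasFDerivAt.restrictScalars ℝ).comp v Z.hasFDerivAt
    exact h1.const_mul (c i)
  have hz : ∑ i : Fin 5, c i • Z (Pi.single i 1) = 0 := by
    ext μ
    rw [Fin.sum_univ_succ]
    simp only [Finset.sum_apply, Pi.smul_apply, Pi.add_apply, Pi.zero_apply, hZ, smul_eq_mul, hc,
      Fin.cons_zero, Fin.cons_succ]
    simp [Pi.single_apply, Fin.succ_ne_zero, apply_ite Complex.ofReal, mul_ite, Finset.sum_ite_eq]
  have hdiv : ∀ v, ∑ i, f' i v (Pi.single i 1) = 0 := by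
    intro v
    have e : ∑ i, f' i v (Pi.single i 1) =
        (fderiv ℂ φ (Z v)) (∑ i, c i • Z (Pi.single i 1)) := by
      rw [map_sum]
      simp [hf']
    rw [e, hz, map_zero]
  have Hc : ∀ i, ContinuousOn (f i) (Set.Icc a b) := fun i =>
    (continuous_const.mul (hφc.comp Z.continuous)).continuousOn
  have Hi : IntegrableOn (fun x => ∑ i, f' i x (Pi.single i 1)) (Set.Icc a b) := by
    have e : (fun x => ∑ i, f' i x (Pi.single i 1)) = fun _ => 0 := funext hdiv
    rw [e]
    exact integrableOn_zero
  have hmain := integral_divergence_of_hasFDerivAt_off_countable' a b hab f f' ∅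
    Set.countable_empty Hc (fun x _ i => Hd x i) Hi
  have e0 : (∫ x in Set.Icc a b, ∑ i, f' i x (Pi.single i 1)) = 0 := by
    simp_rw [hdiv]; simp
  rw [e0, Fin.sum_univ_succ] at hmain
  -- the side faces cancel by periodicity
  have hside : ∀ ν : Fin 4, ∀ x : Fin 4 → ℝ,
      f ν.succ (Fin.insertNth ν.succ (b ν.succ) x) =
        f ν.succ (Fin.insertNth ν.succ (a ν.succ) x) := by
    intro ν x
    simp only [hf]
    congr 1
    rw [insertNth_eq_add_single ν.succ (b ν.succ) (a ν.succ) x, map_add]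
    have hs : b ν.succ - a ν.succ = 2 * Real.pi := by simp [ha, hb]; ring
    rw [hs]
    have hupd : Z (Fin.insertNth ν.succ (a ν.succ) x) + Z (Pi.single ν.succ (2 * Real.pi)) =
        Function.update (Z (Fin.insertNth ν.succ (a ν.succ) x)) ν
          (Z (Fin.insertNth ν.succ (a ν.succ) x) ν + 2 * Real.pi) := by
      ext μ
      rw [Function.update_apply, Pi.add_apply, hZ (Pi.single _ _)]
      by_cases h : μ = ν
      · subst h; simp
      · simp [h, Fin.succ_ne_zero]
    rw [hupd, hper]
  have hsum0 : ∑ ν : Fin 4,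
      ((∫ x in Set.Icc (a ∘ Fin.succAbove ν.succ) (b ∘ Fin.succAbove ν.succ),
          f ν.succ (Fin.insertNth ν.succ (b ν.succ) x)) -
        ∫ x in Set.Icc (a ∘ Fin.succAbove ν.succ) (b ∘ Fin.succAbove ν.succ),
          f ν.succ (Fin.insertNth ν.succ (a ν.succ) x)) = 0 := by
    refine Finset.sum_eq_zero fun ν _ => ?_
    simp_rw [hside]
    simp
  rw [hsum0, add_zero] at hmain
  -- the faces `s = 1` and `s = 0`
  have hface : (a ∘ Fin.succAbove 0 : Fin 4 → ℝ) = (fun _ => -Real.pi) ∧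
      (b ∘ Fin.succAbove 0 : Fin 4 → ℝ) = (fun _ => Real.pi) := by
    constructor <;> funext j <;> simp [ha, hb]
  rw [hface.1, hface.2] at hmain
  have hf0 : ∀ v, f 0 v = φ (Z v) := fun v => by simp [hf, hc]
  simp_rw [hf0] at hmain
  have hb0 : b 0 = 1 := by simp [hb]
  have ha0 : a 0 = 0 := by simp [ha]
  simp only [hb0, ha0, Fin.insertNth_zero'] at hmain
  linear_combination (norm := skip) -hmain
  ring_nf

/-- `2π`-periodicity of the complexified free integrand in each momentum coordinate (the
character `e^{iζ·w}` is periodic because `w ∈ ℤ⁴`). -/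
theorem cexp_symbol_update_add_two_pi (t : ℝ) (w : Site 4) (ξ : Fin 4 → ℂ) (ν : Fin 4) :
    Complex.exp (-(t : ℂ) *
        ((∑ μ, Complex.sin (Function.update ξ ν (ξ ν + 2 * Real.pi) μ) ^ 2) +
          (∑ μ, (1 - Complex.cos (Function.update ξ ν (ξ ν + 2 * Real.pi) μ))) ^ 2) +
        Complex.I * ∑ μ, Function.update ξ ν (ξ ν + 2 * Real.pi) μ * ((w μ : ℤ) : ℂ)) =
      Complex.exp (-(t : ℂ) * ((∑ μ, Complex.sin (ξ μ) ^ 2) + (∑ μ, (1 - Complex.cos (ξ μ))) ^ 2) +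
        Complex.I * ∑ μ, ξ μ * ((w μ : ℤ) : ℂ)) := by
  have hs : ∀ μ, Complex.sin (Function.update ξ ν (ξ ν + 2 * Real.pi) μ) = Complex.sin (ξ μ) := by
    intro μ
    rcases eq_or_ne μ ν with rfl | h
    · simp [Complex.sin_add_two_pi]
    · simp [h]
  have hc : ∀ μ, Complex.cos (Function.update ξ ν (ξ ν + 2 * Real.pi) μ) = Complex.cos (ξ μ) := by
    intro μ
    rcases eq_or_ne μ ν with rfl | h
    · simp [Complex.cos_add_two_pi]
    · simp [h]
  have hph : ∀ μ, Function.update ξ ν (ξ ν + 2 * Real.pi) μ * ((w μ : ℤ) : ℂ) =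
      ξ μ * ((w μ : ℤ) : ℂ) + (if μ = ν then 2 * Real.pi * ((w ν : ℤ) : ℂ) else 0) := by
    intro μ
    rcases eq_or_ne μ ν with rfl | h
    · simp; ring
    · simp [h]
  simp_rw [hs, hc, hph]
  rw [Finset.sum_add_distrib, Finset.sum_ite_eq' Finset.univ ν, if_pos (Finset.mem_univ ν)]
  rw [show -(t : ℂ) * ((∑ μ, Complex.sin (ξ μ) ^ 2) + (∑ μ, (1 - Complex.cos (ξ μ))) ^ 2) +
      Complex.I * (∑ μ, ξ μ * ((w μ : ℤ) : ℂ) + 2 * Real.pi * ((w ν : ℤ) : ℂ)) =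
      (-(t : ℂ) * ((∑ μ, Complex.sin (ξ μ) ^ 2) + (∑ μ, (1 - Complex.cos (ξ μ))) ^ 2) +
        Complex.I * ∑ μ, ξ μ * ((w μ : ℤ) : ℂ)) + ((w ν : ℤ) : ℂ) * (2 * Real.pi * Complex.I) by ring,
    Complex.exp_add, Complex.exp_int_mul_two_pi_mul_I, mul_one]

/-- THE CONTOUR SHIFT of the free Brillouin-zone integrand: for every `η ∈ ℝ⁴`,
`∫_{[−π,π]⁴} exp(−t H(p + iη) + i(p + iη)·w) dp = ∫_{[−π,π]⁴} exp(−t H(p) + i p·w) dp`. -/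
theorem setIntegral_cexp_symbol_shift (t : ℝ) (w : Site 4) (η : Fin 4 → ℝ) :
    ∫ x in Set.Icc (fun _ : Fin 4 => -Real.pi) (fun _ => Real.pi),
        Complex.exp (-(t : ℂ) *
          ((∑ μ, Complex.sin ((x μ : ℂ) + (η μ : ℂ) * Complex.I) ^ 2) +
            (∑ μ, (1 - Complex.cos ((x μ : ℂ) + (η μ : ℂ) * Complex.I))) ^ 2) +
          Complex.I * ∑ μ, ((x μ : ℂ) + (η μ : ℂ) * Complex.I) * ((w μ : ℤ) : ℂ)) =
      ∫ x in Set.Icc (fun _ : Fin 4 => -Real.pi) (fun _ => Real.pi),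
        Complex.exp (-(t : ℂ) * ((∑ μ, Complex.sin (x μ : ℂ) ^ 2) +
          (∑ μ, (1 - Complex.cos (x μ : ℂ))) ^ 2) + Complex.I * ∑ μ, (x μ : ℂ) * ((w μ : ℤ) : ℂ)) := by
  set φ : (Fin 4 → ℂ) → ℂ := fun ξ => Complex.exp (-(t : ℂ) *
    ((∑ μ, Complex.sin (ξ μ) ^ 2) + (∑ μ, (1 - Complex.cos (ξ μ))) ^ 2) +
      Complex.I * ∑ μ, ξ μ * ((w μ : ℤ) : ℂ)) with hφdef
  have hφ : Differentiable ℂ φ := by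
    rw [hφdef]
    fun_prop
  have hper : ∀ (ξ : Fin 4 → ℂ) (ν : Fin 4), φ (Function.update ξ ν (ξ ν + 2 * Real.pi)) = φ ξ :=
    fun ξ ν => cexp_symbol_update_add_two_pi t w ξ ν
  set Z : (Fin 5 → ℝ) →L[ℝ] (Fin 4 → ℂ) := ContinuousLinearMap.pi fun μ : Fin 4 =>
    Complex.ofRealCLM.comp (ContinuousLinearMap.proj (R := ℝ) (φ := fun _ : Fin 5 => ℝ) μ.succ) +
      ((η μ : ℂ) * Complex.I) • Complex.ofRealCLM.comp
        (ContinuousLinearMap.proj (R := ℝ) (φ := fun _ : Fin 5 => ℝ) 0) with hZdef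
  have hZ : ∀ v μ, Z v μ = (v μ.succ : ℂ) + ((v 0 * η μ : ℝ) : ℂ) * Complex.I := by
    intro v μ
    simp [hZdef]
    ring
  have h := setIntegral_shift_of_periodic φ hφ hper Z η hZ
  have h1 : ∀ x : Fin 4 → ℝ, φ (Z (Fin.cons 1 x : Fin 5 → ℝ)) = Complex.exp (-(t : ℂ) *
      ((∑ μ, Complex.sin ((x μ : ℂ) + (η μ : ℂ) * Complex.I) ^ 2) +
        (∑ μ, (1 - Complex.cos ((x μ : ℂ) + (η μ : ℂ) * Complex.I))) ^ 2) +
      Complex.I * ∑ μ, ((x μ : ℂ) + (η μ : ℂ) * Complex.I) * ((w μ : ℤ) : ℂ)) := by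
    intro x
    simp only [hφdef, hZ, Fin.cons_succ, Fin.cons_zero, one_mul]
  have h0 : ∀ x : Fin 4 → ℝ, φ (Z (Fin.cons 0 x : Fin 5 → ℝ)) = Complex.exp (-(t : ℂ) *
      ((∑ μ, Complex.sin (x μ : ℂ) ^ 2) + (∑ μ, (1 - Complex.cos (x μ : ℂ))) ^ 2) +
      Complex.I * ∑ μ, (x μ : ℂ) * ((w μ : ℤ) : ℂ)) := by
    intro x
    simp only [hφdef, hZ, Fin.cons_succ, Fin.cons_zero, zero_mul, Complex.ofReal_zero, add_zero]
  simp_rw [h1, h0] at h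
  exact h

/-- Registered headline of this helper file (aux stub of `stub_freeMajorantToolkit`): the contour
shift of the free Brillouin-zone integrand. -/
theorem stub_freeMajorantToolkitAuxE : ∀ (t : ℝ) (w : Site 4) (η : Fin 4 → ℝ), ∫ x in Set.Icc (fun _ : Fin 4 => -Real.pi) (fun _ => Real.pi), Complex.exp (-(t : ℂ) * ((∑ μ, Complex.sin ((x μ : ℂ) + (η μ : ℂ) * Complex.I) ^ 2) + (∑ μ, (1 - Complex.cos ((x μ : ℂ) + (η μ : ℂ) * Complex.I))) ^ 2) + Complex.I * ∑ μ, ((x μ : ℂ) + (η μ : ℂ) * Complex.I) * ((w μ : ℤ) : ℂ)) = ∫ x in Set.Icc (fun _ : Fin 4 => -Real.pi) (fun _ => Real.pi), Complex.exp (-(t : ℂ) * ((∑ μ, Complex.sin (x μ : ℂ) ^ 2) + (∑ μ, (1 - Complex.cos (x μ : ℂ))) ^ 2) + Complex.I * ∑ μ, (x μ : ℂ) * ((w μ : ℤ) : ℂ)) :=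
  fun t w η => setIntegral_cexp_symbol_shift t w η

end Summit.QuantumFields.QCD.Cruxes.QuarkLoopCoefficient.Sketch.FreeMajorantToolkit
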